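import Literature.NumberTheory.ZetaValues.AperyLikeGeneratingFunctions
import HarnessLib

/-!
# A WZ pair for Tauraso's bivariate generating function of `ζ(2+r+2s)` (GF2)

Topic `Literature/NumberTheory/ZetaValues`. The identity [Tauraso2020, (2) = (GF2)] (tree: `tauraso2020_bivariate`),
`Σ_{k≥1} 1/(k² − ak − b²) = Σ_{k≥1} ((3k−a)/(k C(2k,k))) ∏_{j<k}(j² − a² − 4b²)/∏_{j≤k}(j² − aj − b²)`,
is proved in the source by partial fractions and the infinite companion of its Theorem 1, and by Kh. & T. Hessami
Pilehrood (Electron. J. Combin. 18(2) (2012) P35 = arXiv:1104.3659, (eq09): `Σ_{k≥0} 1/((k+α)²−x²) =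
Σ_{n≥1} (3n+2α−2)(1+2x)_{n−1}(1−2x)_{n−1}/(n C(2n,n)(α+x)_n(α−x)_n)`, the same identity at `α = 1 − a/2`,
`x² = a²/4 + b²`) as a limit of a two-parameter Markov–WZ identity. Here it gets a DIRECT Wilf–Zeilberger certificate:
with `Q(m) = m² − am − b²`, `S(m) = m² − a² − 4b²`, the kernel `H(n,k) = 1/∏_{i=0}^{n} Q(k+1+i)` and
`κ_n = n!² ∏_{j≤n} S(j)/(2n)!`, the pair
`F(n,k) = κ_n H(n,k)`, `G(n,k) = κ_n · (2k + 3n + 3 − a)/(2(2n+1)) · H(n,k)`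
satisfies `F(n+1,k) − F(n,k) = G(n,k+1) − G(n,k)` (`tauraso_wz`; found by the Gosper ansatz `G = F·(Ak+B)`, which
forces `A = 1/(2n+1)`, `B = (3n+3−a)/(2(2n+1))`, `κ_{n+1}/κ_n = (n+1)² S(n+1)/((2n+1)(2n+2))`; at `a = 0` it is the
pair of [HessamiPilehrood2008WZ, §4] for the Bailey–Borwein–Bradley identity), with `F(0,k) = 1/Q(k+1)`
(`tauraso_F_zero`) and `G(n,0)` = the `k = n+1` summand of the right-hand side of (GF2) (`tauraso_G_zero`).
`tauraso_Q_ne_zero`: no `Q(m)`, `m ≥ 1`, vanishes when `|a| + |b|² < 1` (`‖Q(m)‖ ≥ m(m − |a| − |b|²)`). The summation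
and the boundary estimates are in `TaurasoBivariateProofs.lean`. No definitions (`let`-bound lambdas).
-/

open Finset

noncomputable section

namespace Literature.NumberTheory.ZetaValues

/-- For `|a| + |b|² < 1`... more precisely for any `a, b` and real `x ≥ 1`: `‖x² − ax − b²‖ ≥ x(x − (‖a‖ + ‖b‖²))`;
so the denominators `j² − aj − b²` of [Tauraso2020, (2)] do not vanish under its hypothesis.
[cite: Tauraso2020, §1 (2) (the hypothesis making both sides converge)] -/
theorem tauraso_norm_Q_ge (a b : ℂ) {x : ℝ} (hx : 1 ≤ x) :
    x * (x - (‖a‖ + ‖b‖ ^ 2)) ≤ ‖((x : ℂ)) ^ 2 - a * ((x : ℂ)) - b ^ 2‖ := by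
  have h1 : ‖((x : ℂ)) ^ 2‖ = x ^ 2 := by
    rw [norm_pow, Complex.norm_real, Real.norm_of_nonneg (by linarith)]
  have h2 : ‖a * ((x : ℂ)) + b ^ 2‖ ≤ ‖a‖ * x + ‖b‖ ^ 2 := by
    refine (norm_add_le _ _).trans ?_
    rw [norm_mul, norm_pow, Complex.norm_real, Real.norm_of_nonneg (by linarith)]
  have h3 : ‖((x : ℂ)) ^ 2 - a * ((x : ℂ)) - b ^ 2‖ ≥ ‖((x : ℂ)) ^ 2‖ - ‖a * ((x : ℂ)) + b ^ 2‖ := by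
    rw [sub_sub]; exact norm_sub_norm_le _ _
  have hb : ‖b‖ ^ 2 ≤ ‖b‖ ^ 2 * x := le_mul_of_one_le_right (by positivity) hx
  nlinarith [norm_nonneg a, norm_nonneg b]

/-- `Q(m) = m² − am − b² ≠ 0` for integers `m ≥ 1` when `|a| + |b|² < 1`. [cite: Tauraso2020, §1 (2) (hypothesis)] -/
theorem tauraso_Q_ne_zero {a b : ℂ} (hab : ‖a‖ + ‖b‖ ^ 2 < 1) (m : ℕ) :
    ((m : ℂ) + 1) ^ 2 - a * ((m : ℂ) + 1) - b ^ 2 ≠ 0 := by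
  have hx : (1 : ℝ) ≤ (m : ℝ) + 1 := by linarith [(m.cast_nonneg : (0 : ℝ) ≤ m)]
  have h := tauraso_norm_Q_ge a b hx
  have hpos : 0 < ((m : ℝ) + 1) * (((m : ℝ) + 1) - (‖a‖ + ‖b‖ ^ 2)) := mul_pos (by positivity) (by linarith)
  intro h0
  have e : ((((m : ℝ) + 1 : ℝ)) : ℂ) = (m : ℂ) + 1 := by push_cast; ring
  rw [e, h0, norm_zero] at h
  linarith

/-- **The WZ relation** `F(n+1,k) − F(n,k) = G(n,k+1) − G(n,k)` for the pair of this file, valid whenever no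
`Q(m)`, `m ≥ 1`, vanishes (a rational identity; the certificate `(2k+3n+3−a)/(2(2n+1))` found by the Gosper ansatz).
[cite: Tauraso2020, §1 (2)] [cite: HessamiPilehrood2008WZ, §4 (the case a = 0: the Bailey–Borwein–Bradley pair)] -/
theorem tauraso_wz {a b : ℂ} (hQ : ∀ m : ℕ, ((m : ℂ) + 1) ^ 2 - a * ((m : ℂ) + 1) - b ^ 2 ≠ 0) (n k : ℕ) :
    let F : ℕ → ℕ → ℂ := fun n k =>
      ((n.factorial : ℂ) ^ 2 / ((2 * n).factorial : ℂ) * ∏ j ∈ range n, (((j : ℂ) + 1) ^ 2 - a ^ 2 - 4 * b ^ 2)) * (∏ i ∈ range (n + 1), (((k : ℂ) + 1 + i) ^ 2 - a * ((k : ℂ) + 1 + i) - b ^ 2))⁻¹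
    let G : ℕ → ℕ → ℂ := fun n k =>
      ((n.factorial : ℂ) ^ 2 / ((2 * n).factorial : ℂ) * ∏ j ∈ range n, (((j : ℂ) + 1) ^ 2 - a ^ 2 - 4 * b ^ 2)) *
        ((2 * (k : ℂ) + 3 * n + 3 - a) / (2 * (2 * (n : ℂ) + 1))) * (∏ i ∈ range (n + 1), (((k : ℂ) + 1 + i) ^ 2 - a * ((k : ℂ) + 1 + i) - b ^ 2))⁻¹
    F (n + 1) k - F n k = G n (k + 1) - G n k := by
  intro F G
  simp only [F, G]
  have hQ1 : (((k : ℂ) + 1) ^ 2 - a * ((k : ℂ) + 1) - b ^ 2) ≠ 0 := hQ k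
  have hQ2 : (((k : ℂ) + 1 + ((n : ℂ) + 1)) ^ 2 - a * ((k : ℂ) + 1 + ((n : ℂ) + 1)) - b ^ 2) ≠ 0 := by
    have h := hQ (k + n + 1); push_cast at h; ring_nf at h ⊢; exact h
  have hPP : (∏ i ∈ range (n + 1), (((k : ℂ) + 1 + i) ^ 2 - a * ((k : ℂ) + 1 + i) - b ^ 2)) ≠ 0 :=
    prod_ne_zero_iff.2 fun i _ => by have h := hQ (k + i); push_cast at h; ring_nf at h ⊢; exact h
  have ePn : ∏ i ∈ range (n + 1 + 1), (((k : ℂ) + 1 + i) ^ 2 - a * ((k : ℂ) + 1 + i) - b ^ 2) = (∏ i ∈ range (n + 1), (((k : ℂ) + 1 + i) ^ 2 - a * ((k : ℂ) + 1 + i) - b ^ 2)) * (((k : ℂ) + 1 + ((n : ℂ) + 1)) ^ 2 - a * ((k : ℂ) + 1 + ((n : ℂ) + 1)) - b ^ 2) := by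
    rw [prod_range_succ]; push_cast; ring
  have ePk : ∏ i ∈ range (n + 1), (((((k + 1 : ℕ)) : ℂ) + 1 + i) ^ 2 - a * ((((k + 1 : ℕ)) : ℂ) + 1 + i) - b ^ 2) = (∏ i ∈ range (n + 1), (((k : ℂ) + 1 + i) ^ 2 - a * ((k : ℂ) + 1 + i) - b ^ 2)) * (((k : ℂ) + 1 + ((n : ℂ) + 1)) ^ 2 - a * ((k : ℂ) + 1 + ((n : ℂ) + 1)) - b ^ 2) / (((k : ℂ) + 1) ^ 2 - a * ((k : ℂ) + 1) - b ^ 2) := by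
    rw [eq_div_iff hQ1]
    have h := prod_range_succ' (fun i : ℕ => (((k : ℂ) + 1 + i) ^ 2 - a * ((k : ℂ) + 1 + i) - b ^ 2)) (n + 1)
    rw [prod_range_succ] at h
    have e : ∏ i ∈ range (n + 1), (((((k + 1 : ℕ)) : ℂ) + 1 + i) ^ 2 - a * ((((k + 1 : ℕ)) : ℂ) + 1 + i) - b ^ 2) = ∏ i ∈ range (n + 1), (((k : ℂ) + 1 + (((i + 1 : ℕ)) : ℂ)) ^ 2 - a * ((k : ℂ) + 1 + (((i + 1 : ℕ)) : ℂ)) - b ^ 2) :=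
      prod_congr rfl fun i _ => by push_cast; ring
    rw [e]
    push_cast at h ⊢
    simp only [add_zero] at h
    linear_combination -h
  have eκ : ∏ j ∈ range (n + 1), (((j : ℂ) + 1) ^ 2 - a ^ 2 - 4 * b ^ 2) = (∏ j ∈ range n, (((j : ℂ) + 1) ^ 2 - a ^ 2 - 4 * b ^ 2)) * (((n : ℂ) + 1) ^ 2 - a ^ 2 - 4 * b ^ 2) := prod_range_succ _ n
  have efac : ((n + 1).factorial : ℂ) = ((n : ℂ) + 1) * (n.factorial : ℂ) := by
    rw [Nat.factorial_succ]; push_cast; ring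
  have efac2 : ((2 * (n + 1)).factorial : ℂ) = (2 * (n : ℂ) + 2) * (2 * (n : ℂ) + 1) * ((2 * n).factorial : ℂ) := by
    rw [show 2 * (n + 1) = (2 * n) + 1 + 1 by ring, Nat.factorial_succ, Nat.factorial_succ]; push_cast; ring
  rw [ePn, ePk, eκ, efac, efac2]
  have h21 : (2 * (n : ℂ) + 1) ≠ 0 := by norm_cast
  have h22 : (2 * (n : ℂ) + 2) ≠ 0 := by norm_cast
  have hf2 : ((2 * n).factorial : ℂ) ≠ 0 := by exact_mod_cast (Nat.factorial_pos _).ne'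
  push_cast
  set PP : ℂ := ∏ i ∈ range (n + 1), (((k : ℂ) + 1 + i) ^ 2 - a * ((k : ℂ) + 1 + i) - b ^ 2) with hPPdef
  set σ : ℂ := ∏ j ∈ range n, (((j : ℂ) + 1) ^ 2 - a ^ 2 - 4 * b ^ 2) with hσdef
  set Q1 : ℂ := (((k : ℂ) + 1) ^ 2 - a * ((k : ℂ) + 1) - b ^ 2) with hQ1def
  set Q2 : ℂ := (((k : ℂ) + 1 + ((n : ℂ) + 1)) ^ 2 - a * ((k : ℂ) + 1 + ((n : ℂ) + 1)) - b ^ 2) with hQ2def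
  set t1 : ℂ := 2 * (n : ℂ) + 1 with ht1
  field_simp
  rw [hQ1def, hQ2def, ht1]
  ring

/-- `F(0,k) = 1/Q(k+1)`: the general term of the left-hand side of (GF2). [cite: Tauraso2020, §1 (2)] -/
theorem tauraso_F_zero (a b : ℂ) (k : ℕ) :
    let F : ℕ → ℕ → ℂ := fun n k =>
      ((n.factorial : ℂ) ^ 2 / ((2 * n).factorial : ℂ) * ∏ j ∈ range n, (((j : ℂ) + 1) ^ 2 - a ^ 2 - 4 * b ^ 2)) * (∏ i ∈ range (n + 1), (((k : ℂ) + 1 + i) ^ 2 - a * ((k : ℂ) + 1 + i) - b ^ 2))⁻¹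
    F 0 k = 1 / (((k : ℂ) + 1) ^ 2 - a * ((k : ℂ) + 1) - b ^ 2) := by
  intro F
  simp only [F, Nat.cast_zero, zero_add, add_zero, mul_zero, prod_range_one, prod_range_zero,
    Nat.factorial_zero, Nat.cast_one, one_pow, mul_one, div_one, one_div, one_mul]

/-- `2ⁿ⁺¹ (2n+1)! = …`: the central binomial identity `C(2n+2, n+1) (n+1)!² = (2n+2)!` in `ℂ`. [folklore] -/
private theorem centralBinom_succ_mul_sq (n : ℕ) :
    (((n + 1).centralBinom : ℕ) : ℂ) * (((n : ℂ) + 1) * (n.factorial : ℂ)) ^ 2 =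
      (2 * (n : ℂ) + 2) * (2 * (n : ℂ) + 1) * ((2 * n).factorial : ℂ) := by
  have h := Nat.choose_mul_factorial_mul_factorial (show n + 1 ≤ 2 * (n + 1) by omega)
  rw [show 2 * (n + 1) - (n + 1) = n + 1 by omega, ← Nat.centralBinom_eq_two_mul_choose,
    show 2 * (n + 1) = (2 * n) + 1 + 1 by ring, Nat.factorial_succ (2 * n + 1), Nat.factorial_succ (2 * n),
    Nat.factorial_succ n] at h
  have h' : (((n + 1).centralBinom : ℕ) : ℂ) * (((n : ℂ) + 1) * (n.factorial : ℂ)) * (((n : ℂ) + 1) * (n.factorial : ℂ)) =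
      (2 * (n : ℂ) + 1 + 1) * ((2 * (n : ℂ) + 1) * ((2 * n).factorial : ℂ)) := by exact_mod_cast h
  linear_combination h'

/-- `G(n,0)` is the `k = n+1` summand of the right-hand side of (GF2), LITERALLY as typed in `tauraso2020_bivariate`:
`(3(n+1) − a)/((n+1) C(2n+2,n+1)) · ∏_{j ∈ [1,n+1)} S(j) / ∏_{j ∈ [1,n+1]} Q(j)` (`n!²/(2(2n+1)(2n)!) = 1/((n+1)C(2n+2,n+1))`).
[cite: Tauraso2020, §1 (2)] -/
theorem tauraso_G_zero (a b : ℂ) (hQ : ∀ m : ℕ, ((m : ℂ) + 1) ^ 2 - a * ((m : ℂ) + 1) - b ^ 2 ≠ 0) (n : ℕ) :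
    let G : ℕ → ℕ → ℂ := fun n k =>
      ((n.factorial : ℂ) ^ 2 / ((2 * n).factorial : ℂ) * ∏ j ∈ range n, (((j : ℂ) + 1) ^ 2 - a ^ 2 - 4 * b ^ 2)) *
        ((2 * (k : ℂ) + 3 * n + 3 - a) / (2 * (2 * (n : ℂ) + 1))) * (∏ i ∈ range (n + 1), (((k : ℂ) + 1 + i) ^ 2 - a * ((k : ℂ) + 1 + i) - b ^ 2))⁻¹
    G n 0 = (3 * ((n + 1 : ℕ) : ℂ) - a) / (((n + 1 : ℕ) : ℂ) * ((n + 1).centralBinom : ℂ)) *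
      ((∏ j ∈ Finset.Ico 1 (n + 1), ((j : ℂ) ^ 2 - a ^ 2 - 4 * b ^ 2)) /
        ∏ j ∈ Finset.Icc 1 (n + 1), ((j : ℂ) ^ 2 - a * (j : ℂ) - b ^ 2)) := by
  intro G
  simp only [G]
  have eIco : ∏ j ∈ Ico 1 (n + 1), ((j : ℂ) ^ 2 - a ^ 2 - 4 * b ^ 2) = ∏ j ∈ range n, (((j : ℂ) + 1) ^ 2 - a ^ 2 - 4 * b ^ 2) := by
    rw [prod_Ico_eq_prod_range, Nat.add_sub_cancel]
    exact prod_congr rfl fun j _ => by push_cast; ring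
  have eIcc : ∏ j ∈ Icc 1 (n + 1), ((j : ℂ) ^ 2 - a * (j : ℂ) - b ^ 2) = ∏ i ∈ range (n + 1), ((((0 : ℕ) : ℂ) + 1 + i) ^ 2 - a * (((0 : ℕ) : ℂ) + 1 + i) - b ^ 2) := by
    rw [← Finset.Ico_add_one_right_eq_Icc, prod_Ico_eq_prod_range, show n + 1 + 1 - 1 = n + 1 by omega]
    exact prod_congr rfl fun i _ => by push_cast; ring
  rw [eIco, eIcc]
  have hPP : ∏ i ∈ range (n + 1), ((((0 : ℕ) : ℂ) + 1 + i) ^ 2 - a * (((0 : ℕ) : ℂ) + 1 + i) - b ^ 2) ≠ 0 :=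
    prod_ne_zero_iff.2 fun i _ => by have h := hQ i; push_cast at h ⊢; ring_nf at h ⊢; exact h
  have hC : (((n + 1).centralBinom : ℕ) : ℂ) ≠ 0 := by exact_mod_cast (Nat.centralBinom_pos (n + 1)).ne'
  have hnf : (n.factorial : ℂ) ≠ 0 := by exact_mod_cast (Nat.factorial_pos _).ne'
  have hf2 : ((2 * n).factorial : ℂ) ≠ 0 := by exact_mod_cast (Nat.factorial_pos _).ne'
  have hn1 : ((n : ℂ) + 1) ≠ 0 := by norm_cast
  have h21 : (2 * (n : ℂ) + 1) ≠ 0 := by norm_cast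
  have h22 : (2 * (n : ℂ) + 2) ≠ 0 := by norm_cast
  have eC : (((n + 1).centralBinom : ℕ) : ℂ) =
      (2 * (n : ℂ) + 2) * (2 * (n : ℂ) + 1) * ((2 * n).factorial : ℂ) / (((n : ℂ) + 1) * (n.factorial : ℂ)) ^ 2 := by
    rw [eq_div_iff (pow_ne_zero _ (mul_ne_zero hn1 hnf))]; exact centralBinom_succ_mul_sq n
  push_cast
  rw [eC]
  set PP : ℂ := ∏ i ∈ range (n + 1), ((((0 : ℕ) : ℂ) + 1 + i) ^ 2 - a * (((0 : ℕ) : ℂ) + 1 + i) - b ^ 2)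
  set σ : ℂ := ∏ j ∈ range n, (((j : ℂ) + 1) ^ 2 - a ^ 2 - 4 * b ^ 2)
  field_simp
  ring

end Literature.NumberTheory.ZetaValues
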